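import Summits.AnomalousDissipation.AnomalousDissipation.Theorems.SawtoothPulseCascadeK1LocalisedCascadeItinRow

/-!
# K1loc, line `Spectral` — S-D (first good piece): PREPENDING A PHASE TO AN ITINERARY

Helper file of the prover lane on the crux `K1LocalisedCascade` (stmt-AnomalousDissipation-19491), route
`SawtoothPulseCascade`, registered line `Cruxes.K1LocalisedCascade.Spectral` (one open stub `stub_highModeConcentration`).
Three small inputs of the line refinement (`…LineRefine`): `abs_itinJac_cons_entry_ge` — prepending a sign pair gains a factor
`γ² − 3` on the cell frequency `(itinJac γ L)₀₀` (column cone, `…ItinRow.col_cone_itinJac`); `pieceItin_cons` — the itinerary of a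
child piece is the parent's with the new pair prepended; `card_Icc_le`.
[cite: ElgindiLissMattingly2025, §3.1 Lemma 3.1] [problem: turb]
-/

-- `Summit.<Summit>.<Problem>`: single-conjunct summit, the duplicate namespace segment is deliberate.
set_option linter.dupNamespace false

noncomputable section

namespace Summit.AnomalousDissipation.AnomalousDissipation.Theorems.SawtoothPulseCascade.K1Start

open Set Matrix Function
open Literature.Analysis.FluidPDE.SawtoothCascade

/-! ## §1 Prepending a phase -/

/-- **Per-phase gain of the potential (prepended phase)**: for a sign list `L`, signs `r, s` and `γ² ≥ 8`:
`|(itinJac γ ((r,s) :: L))₀₀| ≥ (γ² − 3)|(itinJac γ L)₀₀|` (column cone of `L`: the new entry is `(1 + rsγ²)J₀₀ + rγJ₁₀`).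
[cite: ElgindiLissMattingly2025, §3.1 Lemma 3.1] -/
theorem abs_itinJac_cons_entry_ge {γ : ℝ} (hγ : 0 < γ) (h8 : 8 ≤ γ ^ 2) {L : List (ℝ × ℝ)} (hL : IsSignList L) {r s : ℝ}
    (hr : r = 1 ∨ r = -1) (hs : s = 1 ∨ s = -1) :
    (γ ^ 2 - 3) * |itinJac γ L 0 0| ≤ |itinJac γ ((r, s) :: L) 0 0| := by
  have hcol := (col_cone_itinJac hγ h8 hL).1
  have e : itinJac γ ((r, s) :: L) 0 0 = (1 + r * s * γ ^ 2) * itinJac γ L 0 0 + r * γ * itinJac γ L 1 0 := by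
    simp [itinJac, Matrix.mul_apply, Fin.sum_univ_two, pulseJac]
  rw [e]
  have hrs : r * s = 1 ∨ r * s = -1 := by
    rcases hr with rfl | rfl <;> rcases hs with rfl | rfl <;> norm_num
  have hr1 : |r| = 1 := by rcases hr with rfl | rfl <;> norm_num
  set a := itinJac γ L 0 0
  set c := itinJac γ L 1 0
  have hb : |r * γ * c| ≤ 2 * |a| := by
    rw [abs_mul, abs_mul, hr1, one_mul, abs_of_pos hγ]; exact hcol
  have hmain : (γ ^ 2 - 1) * |a| ≤ |(1 + r * s * γ ^ 2) * a| := by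
    rw [abs_mul]
    refine mul_le_mul_of_nonneg_right ?_ (abs_nonneg a)
    rcases hrs with h | h <;> rw [h] <;> [rw [abs_of_pos (by nlinarith)]; rw [abs_of_neg (by nlinarith)]] <;> nlinarith
  calc (γ ^ 2 - 3) * |a| = (γ ^ 2 - 1) * |a| - 2 * |a| := by ring
    _ ≤ |(1 + r * s * γ ^ 2) * a| - |r * γ * c| := by linarith
    _ ≤ |(1 + r * s * γ ^ 2) * a + r * γ * c| := by
        have := abs_sub_abs_le_abs_sub ((1 + r * s * γ ^ 2) * a) (-(r * γ * c))
        rw [abs_neg, sub_neg_eq_add] at this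
        exact this

/-- The itinerary of a child piece (level `ℓ + 1`, new ranks `q, q′` at phase `n − ℓ − 1`, the parent's ranks above) is the parent's
itinerary with the new sign pair PREPENDED. [folklore] -/
theorem pieceItin_cons {n ℓ : ℕ} (hℓ : ℓ < n) (pV pH : ℕ → ℤ) (q q' : ℤ) :
    ((List.range (ℓ + 1)).map fun k =>
      (-(1 - 2 * (((if n - (ℓ + 1) + k = n - ℓ - 1 then q' else pH (n - (ℓ + 1) + k)) % 2 : ℤ) : ℝ)),
       -(1 - 2 * (((if n - (ℓ + 1) + k = n - ℓ - 1 then q else pV (n - (ℓ + 1) + k)) % 2 : ℤ) : ℝ)))) =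
    (-(1 - 2 * ((q' % 2 : ℤ) : ℝ)), -(1 - 2 * ((q % 2 : ℤ) : ℝ))) ::
      ((List.range ℓ).map fun k =>
        (-(1 - 2 * ((pH (n - ℓ + k) % 2 : ℤ) : ℝ)), -(1 - 2 * ((pV (n - ℓ + k) % 2 : ℤ) : ℝ)))) := by
  rw [List.range_succ_eq_map, List.map_cons, List.map_map]
  have h0 : n - (ℓ + 1) + 0 = n - ℓ - 1 := by omega
  simp only [h0, if_true]
  congr 1
  refine List.map_congr_left fun k _ => ?_
  have e : n - (ℓ + 1) + (k + 1) = n - ℓ + k := by omega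
  have hne : ¬ (n - ℓ + k = n - ℓ - 1) := by omega
  simp only [Function.comp_apply, Nat.succ_eq_add_one, e, hne, if_false]

/-- `#[x, y] ≤ max(0, y − x + 1)` for an integer interval. [folklore] -/
theorem card_Icc_le (x y : ℤ) : ((Finset.Icc x y).card : ℝ) ≤ max 0 ((y : ℝ) - x + 1) := by
  rw [Int.card_Icc]
  rcases le_or_gt 0 (y + 1 - x) with h | h
  · have : ((y + 1 - x).toNat : ℝ) = (y : ℝ) + 1 - x := by
      rw [show ((y + 1 - x).toNat : ℝ) = (((y + 1 - x).toNat : ℤ) : ℝ) by norm_cast, Int.toNat_of_nonneg h]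
      push_cast; ring
    rw [this]; exact le_trans (by linarith) (le_max_right _ _)
  · rw [Int.toNat_eq_zero.mpr h.le]; push_cast; exact le_max_left _ _

end Summit.AnomalousDissipation.AnomalousDissipation.Theorems.SawtoothPulseCascade.K1Start
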